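import Summits.CriticalPhenomena.PercolationContinuityZ3.Theorems.SahiMasterFamilyGoodDominatesDebt
import Mathlib.Analysis.Calculus.MeanValue
import Mathlib.Analysis.Calculus.Deriv.Mul

/-!
# The RADIAL DERIVATIVE of Sahi's functional from the top vertex, and the hull route
# `(R2-hull)_{k+1} ⇒ (UC-hull)_{k+1}` by monotonicity along the segment `[𝟙, β]`

Unit `prim-masterthm-p4` (gen 29; crux anchor stmt-CriticalPhenomena-4575, helper work; memo
`run/shared/lean/prim/prim-masterthm/prim-masterthm-p4/P4-GEN29-REPORT.md`).  Companion of `…GoodDominatesDebt` (typed (R2) for pairs,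
`r2Slack`) and `…GHConjecture` (`UCHullNonneg`).

SETTING.  `Φ_n(β) = Σ_{π ⊢ [n]} (−1)^{|π|−1} ∏_{B∈π} (|B|−1)!·β_B` (`PrincipalCapBeta.phiSet`) is multi-affine in the values `β_B`.  Its
RADIAL DERIVATIVE FROM THE TOP VERTEX `𝟙 = 1_{2^T}` is `∇Φ_n(β)·(β − 𝟙) = Σ_B (β_B − 1)·∂_BΦ_n(β)`, written out from the definition as
`radialDeriv n β := Σ_π (−1)^{|π|−1} Σ_{B∈π} (∏_{B'∈π, B'≠B} (|B'|−1)!·β_{B'}) · (|B|−1)!·(β_B − 1)`.  Since `∂_BΦ_n = −(|B|−1)!·Φ_{[n]∖B}`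
for `B ≠ univ` (Lieb–Sahi block expansion; `slope_eq_of_last_mem` below records it through the last index), for `β univ = 1` this is the
cycle-weighted block sum `Σ_{∅≠B⊊T} (|B|−1)!·(1−β_B)·Φ_{T∖B}(β|)` = the (R2) form of P4-GEN28 (`GoodDebt.r2Slack` on an edge `β = w1_𝒰 + (1−w)1_𝒱`).
Along the segment `s ↦ β_s := 𝟙 + s(β − 𝟙)` one has `d/ds Φ_n(β_s) = radialDeriv n (β_s) / s` (`hasDerivAt_phiSet_seg`, `radialDeriv_seg`).

RESULTS (all orders, axioms standard):
* `hasDerivAt_phiSet_seg`, `radialDeriv_seg`: the derivative identity along the dilution segment.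
* `phiSet_one_nonneg`: `Φ_{k+1}(𝟙) ≥ 0` (it is `[k = 0]`).
* **`phiSet_ge_of_radialDeriv_nonneg`**: if `radialDeriv (β_s) ≥ 0` for all `s ∈ (0,1)` then `Φ(𝟙) ≤ Φ(β)`, hence `0 ≤ Φ_{k+1}(β)` (mean value theorem
  for the polynomial `s ↦ Φ(β_s)`).
* typed conjecture **`R2Hull k`** ("Sahi's functional is radially non-decreasing from the top vertex on the union-closed polytope": `0 ≤ radialDeriv`
  at every finite mixture of indicators of union-closed families containing `univ`) and **`ucHullNonneg_of_R2Hull : R2Hull k → UCHullNonneg (k+1)`**: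
  the diluted points `β_s` are again such mixtures (add the family `2^T` with weight `1−s`), so the hypothesis feeds the monotonicity lemma.
* pair form **`phiSet_mix_nonneg_of_radialDeriv_seg`**: for ONE pair `(𝒰,𝒱)`, `radialDeriv ≥ 0` along the dilution segments of its edge points
  (the 3-family mixtures `(sw, s(1−w), 1−s)` of `𝒰, 𝒱, 2^T`) gives `Φ_{k+1}(w1_𝒰 + (1−w)1_𝒱) ≥ 0` for `w ∈ [0,1]` — conjecture (B) for the pair, pointwise.
* `radialDeriv_eq_sum_slope`, `hasDerivAt_phiSet_update`, `slope_eq_of_last_mem`: `radialDeriv = Σ_B (β_B − 1)·slope_B`, `slope_B = ∂_BΦ`, and for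
  blocks through the last index `slope_B = (|B|−1)!·κ_B` with `κ_B` the complementary factor of the tree's block expansion (`= −Φ(β|_{Bᶜ})`,
  `BernsteinPos.exists_emb_coRest`).
EVIDENCE for `R2Hull` / (R2) (exact arithmetic outside the kernel, P4-GEN28-REPORT §2, P4-GEN29-REPORT): coefficientwise for all two-sided pairs on ≤ 5 points
(exhaustive), on every structured family of the programme to 12–14 points (including the bi-glued pairs that refute (GD)), on the exhaustively enumerated
2-block-invariant pairs on 6–8 points, on random multi-block-invariant pairs to 12 points and on diluted / 3-family mixtures; the dilution form
`radialDeriv ≥ 0` along `[𝟙, β]` holds for all 374 715 two-sided pairs on 4 points.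
HONEST FRAMING: a reduction (the hull/segment route of the memo made kernel), not a proof; `R2Hull`, (R2), (B), `UCHullNonneg k` (k ≥ 8), Sahi's `C_k`
and the master theorem remain OPEN. [this work]
-/

noncomputable section

open scoped Classical

namespace Summit.CriticalPhenomena.PercolationContinuityZ3.Theorems

namespace RadialDeriv

open Finset Function Equiv
open Literature.Combinatorics.Sahi2008
open Literature.Combinatorics.Sahi2008.CycleForm
open PrincipalCapBeta (phiSet realF realW)
open BernsteinPos RootSummed

/-! ### The radial derivative and the dilution segment -/

/-- **`∇Φ_n(β)·(β − 𝟙)`** written out from the set-partition form: for every partition, the sum over its blocks `B` of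
`(∏_{B' ≠ B} (|B'|−1)!·β_{B'}) · (|B|−1)!·(β_B − 1)`. [this work] -/
def radialDeriv (n : ℕ) (β : Finset (Fin n) → ℝ) : ℝ :=
  ∑ c : OrderedFinpartition n, (-1 : ℝ) ^ (c.length - 1) *
    ∑ j : Fin c.length, (∏ i ∈ univ.erase j, (((c.partSize i - 1).factorial : ℝ) * β (PartitionForm.block c i))) *
      (((c.partSize j - 1).factorial : ℝ) * (β (PartitionForm.block c j) - 1))

/-- The dilution segment from the top vertex: `β_s = 𝟙 + s·(β − 𝟙)` (`β_0 = 𝟙`, `β_1 = β`). [this work] -/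
def seg {n : ℕ} (β : Finset (Fin n) → ℝ) (s : ℝ) : Finset (Fin n) → ℝ := fun S => 1 + s * (β S - 1)

/-- The `s`-derivative of `Φ_n(β_s)` written out blockwise. [this work] -/
def segDeriv (n : ℕ) (β : Finset (Fin n) → ℝ) (s : ℝ) : ℝ :=
  ∑ c : OrderedFinpartition n, (-1 : ℝ) ^ (c.length - 1) *
    ∑ j : Fin c.length, (∏ i ∈ univ.erase j, (((c.partSize i - 1).factorial : ℝ) * seg β s (PartitionForm.block c i))) *
      (((c.partSize j - 1).factorial : ℝ) * (β (PartitionForm.block c j) - 1))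

variable {n : ℕ}

/-- `β_1 = β`. [this work] -/
theorem seg_one (β : Finset (Fin n) → ℝ) : seg β 1 = β := by
  funext S; simp [seg]

/-- `β_0 = 𝟙`. [this work] -/
theorem seg_zero (β : Finset (Fin n) → ℝ) : seg β 0 = fun _ => 1 := by
  funext S; simp [seg]

/-- **Derivative identity**: `d/ds Φ_n(β_s) = segDeriv n β s`. [this work] -/
theorem hasDerivAt_phiSet_seg (β : Finset (Fin n) → ℝ) (s : ℝ) :
    HasDerivAt (fun s => phiSet n (seg β s)) (segDeriv n β s) s := by
  unfold phiSet segDeriv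
  apply HasDerivAt.fun_sum
  intro c _
  refine HasDerivAt.const_mul _ ?_
  have hf : ∀ i ∈ (univ : Finset (Fin c.length)),
      HasDerivAt (fun s => (((c.partSize i - 1).factorial : ℝ) * seg β s (PartitionForm.block c i)))
        (((c.partSize i - 1).factorial : ℝ) * (β (PartitionForm.block c i) - 1)) s := by
    intro i _
    refine HasDerivAt.const_mul _ ?_
    unfold seg
    have h1 : HasDerivAt (fun s : ℝ => s * (β (PartitionForm.block c i) - 1)) (1 * (β (PartitionForm.block c i) - 1)) s :=
      (hasDerivAt_id s).mul_const _
    rw [one_mul] at h1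
    exact h1.const_add 1
  have := HasDerivAt.fun_finsetProd hf
  simp only [smul_eq_mul] at this
  exact this

/-- `radialDeriv` at a segment point is `s` times the segment derivative. [this work] -/
theorem radialDeriv_seg (β : Finset (Fin n) → ℝ) (s : ℝ) : radialDeriv n (seg β s) = s * segDeriv n β s := by
  unfold radialDeriv segDeriv
  simp only [Finset.mul_sum]
  refine sum_congr rfl fun c _ => sum_congr rfl fun j _ => ?_
  simp only [seg]
  ring

/-- `Φ_{k+1}(𝟙) ≥ 0` (indeed `= [k = 0]`: the cap closed form at `β = 𝟙` is a sum of empty-or-vanishing products). [this work] -/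
theorem phiSet_one_nonneg (k : ℕ) : 0 ≤ phiSet (k + 1) (fun _ : Finset (Fin (k + 1)) => (1 : ℝ)) := by
  have h := PhiCapClosedForm.phiSet_cap_eq_sum_perm (fun _ : Finset (Fin (k + 1)) => (1 : ℝ)) rfl
  have e : (fun B : Finset (Fin (k + 1)) => if Fin.last k ∈ B then (1 : ℝ) else 1) = fun _ => 1 := by
    funext B; split_ifs <;> rfl
  rw [e] at h
  rw [h]
  exact sum_nonneg fun σ _ => prod_nonneg fun B _ => by norm_num

/-- **Monotonicity along the segment**: if the radial derivative is nonnegative at every interior point of `[𝟙, β]` then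
`Φ_n(𝟙) ≤ Φ_n(β)`. [this work] -/
theorem phiSet_one_le_of_radialDeriv_nonneg (β : Finset (Fin n) → ℝ)
    (h : ∀ s : ℝ, 0 < s → s < 1 → 0 ≤ radialDeriv n (seg β s)) :
    phiSet n (fun _ => 1) ≤ phiSet n β := by
  let f : ℝ → ℝ := fun s => phiSet n (seg β s)
  have hderiv : ∀ s, HasDerivAt f (segDeriv n β s) s := hasDerivAt_phiSet_seg β
  have hmono : MonotoneOn f (Set.Icc 0 1) := by
    refine monotoneOn_of_deriv_nonneg (convex_Icc 0 1) ?_ ?_ ?_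
    · exact fun s _ => (hderiv s).continuousAt.continuousWithinAt
    · exact fun s _ => (hderiv s).differentiableAt.differentiableWithinAt
    · intro s hs
      rw [interior_Icc] at hs
      rw [(hderiv s).deriv]
      have hrs := h s hs.1 hs.2
      rw [radialDeriv_seg] at hrs
      exact (mul_nonneg_iff_of_pos_left hs.1).1 hrs
  have h01 := hmono (Set.left_mem_Icc.2 zero_le_one) (Set.right_mem_Icc.2 zero_le_one) zero_le_one
  have e0 : f 0 = phiSet n (fun _ => 1) := by show phiSet n (seg β 0) = _; rw [seg_zero]
  have e1 : f 1 = phiSet n β := by show phiSet n (seg β 1) = _; rw [seg_one]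
  rw [← e0, ← e1]; exact h01

/-- Corollary at order `k+1`: `0 ≤ Φ_{k+1}(β)` under the same hypothesis. [this work] -/
theorem phiSet_nonneg_of_radialDeriv_nonneg {k : ℕ} (β : Finset (Fin (k + 1)) → ℝ)
    (h : ∀ s : ℝ, 0 < s → s < 1 → 0 ≤ radialDeriv (k + 1) (seg β s)) : 0 ≤ phiSet (k + 1) β :=
  (phiSet_one_nonneg k).trans (phiSet_one_le_of_radialDeriv_nonneg β h)

/-! ### The hull route: `(R2-hull)_{k+1} ⇒ (UC-hull)_{k+1}` -/

/-- **CONJECTURE (R2-hull) at order `k+1`** (P4-GEN28 §1b / P4-GEN29): Sahi's functional is radially non-decreasing from the top vertex on the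
union-closed polytope — for every finite mixture `β = Σ_x w_x 1_{𝒰_x}` of indicators of union-closed families of subsets of `Fin (k+1)` containing `univ`,
`0 ≤ ∇Φ_{k+1}(β)·(β − 𝟙) = radialDeriv (k+1) β`.  On an edge it is the pointwise form of `GoodDebt.R2 k`; numerically/coefficientwise unrefuted (module
docstring).  A conjecture-valued definition, never a fact. [this work] [status: open] -/
@[conjecture] def R2Hull (k : ℕ) : Prop :=
  ∀ (α : Type) [Fintype α] (w : α → ℝ) (𝒰 : α → Finset (Finset (Fin (k + 1)))),
    (∀ x, 0 ≤ w x) → ∑ x, w x = 1 → (∀ x, ∀ A ∈ 𝒰 x, ∀ A' ∈ 𝒰 x, A ∪ A' ∈ 𝒰 x) → (∀ x, univ ∈ 𝒰 x) →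
      0 ≤ radialDeriv (k + 1) (fun S => ∑ x, w x * (if S ∈ 𝒰 x then (1 : ℝ) else 0))

/-- The diluted point `β_s` of a mixture is the mixture with the extra family `2^T` carrying weight `1 − s`. [this work] -/
theorem seg_mixture_eq {k : ℕ} {α : Type} [Fintype α] (w : α → ℝ) (𝒰 : α → Finset (Finset (Fin (k + 1)))) (s : ℝ) :
    seg (fun S => ∑ x, w x * (if S ∈ 𝒰 x then (1 : ℝ) else 0)) s =
      fun S => ∑ x : Option α, (Option.elim x (1 - s) (fun y => s * w y)) *
        (if S ∈ (Option.elim x (univ : Finset (Fin (k + 1))).powerset 𝒰) then (1 : ℝ) else 0) := by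
  funext S
  rw [Fintype.sum_option]
  simp only [Option.elim_none, Option.elim_some, seg, Finset.mem_powerset, Finset.subset_univ, if_true, mul_one,
    mul_assoc, ← Finset.mul_sum]
  ring

/-- **`(R2-hull)_{k+1} ⇒ (UC-hull)_{k+1}`**: radial monotonicity from the top vertex gives Sahi positivity on the whole union-closed polytope
(`Φ(β) ≥ Φ(𝟙) ≥ 0`). [this work] -/
theorem ucHullNonneg_of_R2Hull {k : ℕ} (h : R2Hull k) : GHConjecture.UCHullNonneg (k + 1) := by
  intro α _ w 𝒰 hw0 hw1 hUC htop
  refine phiSet_nonneg_of_radialDeriv_nonneg _ fun s hs0 hs1 => ?_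
  rw [seg_mixture_eq w 𝒰 s]
  refine h (Option α) (fun x => Option.elim x (1 - s) (fun y => s * w y))
    (fun x => Option.elim x (univ : Finset (Fin (k + 1))).powerset 𝒰) ?_ ?_ ?_ ?_
  · rintro (_ | y)
    · exact sub_nonneg.2 hs1.le
    · exact mul_nonneg hs0.le (hw0 y)
  · rw [Fintype.sum_option]
    simp only [Option.elim]
    rw [← mul_sum, hw1]; ring
  · rintro (_ | y) A hA A' hA'
    · exact mem_powerset.2 (subset_univ _)
    · exact hUC y A hA A' hA'
  · rintro (_ | y)
    · exact mem_powerset.2 (subset_univ _)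
    · exact htop y

/-! ### The pair form: radial nonnegativity along the dilution segments of an edge gives (B) pointwise -/

/-- **Pair form of the segment route**: for one pair `(𝒰, 𝒱)` and `w ∈ [0,1]`, if the radial derivative is `≥ 0` at every diluted point
`𝟙 + s(w1_𝒰 + (1−w)1_𝒱 − 𝟙)`, `s ∈ (0,1)` (the 3-family mixtures `(sw, s(1−w), 1−s)` of `𝒰, 𝒱, 2^T`), then `Φ_{k+1}(w1_𝒰 + (1−w)1_𝒱) ≥ 0` —
conjecture (B) for the pair at `w`, pointwise.  No hypothesis on the families is needed for the implication. [this work] -/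
theorem phiSet_mix_nonneg_of_radialDeriv_seg {k : ℕ} (𝒰 𝒱 : Finset (Finset (Fin (k + 1)))) (w : ℝ)
    (h : ∀ s : ℝ, 0 < s → s < 1 → 0 ≤ radialDeriv (k + 1) (seg (mix 𝒰 𝒱 w) s)) :
    0 ≤ phiSet (k + 1) (mix 𝒰 𝒱 w) :=
  phiSet_nonneg_of_radialDeriv_nonneg _ h

/-! ### `radialDeriv = Σ_B (β_B − 1)·∂_BΦ`, and `∂_BΦ` through the last index is the block-expansion factor -/

/-- The slope of `Φ_n` in the single value `β_B`: `Σ_π (−1)^{|π|−1} Σ_{j : π_j = B} (∏_{i≠j} (|π_i|−1)!β_{π_i})·(|B|−1)!`. [this work] -/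
def slope (n : ℕ) (β : Finset (Fin n) → ℝ) (B : Finset (Fin n)) : ℝ :=
  ∑ c : OrderedFinpartition n, (-1 : ℝ) ^ (c.length - 1) *
    ∑ j : Fin c.length, (∏ i ∈ univ.erase j, (((c.partSize i - 1).factorial : ℝ) * β (PartitionForm.block c i))) *
      (((c.partSize j - 1).factorial : ℝ) * (if PartitionForm.block c j = B then (1 : ℝ) else 0))

/-- **`radialDeriv n β = Σ_B (β_B − 1)·slope n β B`**. [this work] -/
theorem radialDeriv_eq_sum_slope (β : Finset (Fin n) → ℝ) :
    radialDeriv n β = ∑ B : Finset (Fin n), (β B - 1) * slope n β B := by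
  unfold radialDeriv slope
  simp only [Finset.mul_sum]
  rw [Finset.sum_comm]
  refine sum_congr rfl fun c _ => ?_
  rw [Finset.sum_comm]
  refine sum_congr rfl fun j _ => ?_
  simp only [mul_ite, mul_one, mul_zero]
  rw [Finset.sum_ite_eq]
  simp only [Finset.mem_univ, if_true]
  ring

/-- **`slope = ∂_BΦ`**: the function `x ↦ Φ_n(β with β_B := x)` has derivative `slope n β B` (at every `x`; it is affine). [this work] -/
theorem hasDerivAt_phiSet_update (β : Finset (Fin n) → ℝ) (B : Finset (Fin n)) (x : ℝ) :
    HasDerivAt (fun x => phiSet n (update β B x)) (slope n (update β B x) B) x := by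
  unfold phiSet slope
  apply HasDerivAt.fun_sum
  intro c _
  refine HasDerivAt.const_mul _ ?_
  have hf : ∀ i ∈ (univ : Finset (Fin c.length)),
      HasDerivAt (fun x => (((c.partSize i - 1).factorial : ℝ) * update β B x (PartitionForm.block c i)))
        (((c.partSize i - 1).factorial : ℝ) * (if PartitionForm.block c i = B then (1 : ℝ) else 0)) x := by
    intro i _
    refine HasDerivAt.const_mul _ ?_
    by_cases hB : PartitionForm.block c i = B
    · simp only [hB, update_self, if_true]
      exact hasDerivAt_id x
    · simp only [update_of_ne hB, hB, if_false]
      exact hasDerivAt_const x _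
  have := HasDerivAt.fun_finsetProd hf
  simp only [smul_eq_mul] at this
  exact this

/-- **`∂_BΦ` through the last index is the block-expansion factor**: for `last ∈ B`,
`slope (k+1) β B = (|B|−1)!·κ_B(β)` with `κ_B = coRest (realW β) realF B` (`= 1` for `B = univ`, `= −Φ(β|_{Bᶜ})` along an embedding of
`Bᶜ` otherwise, `BernsteinPos.exists_emb_coRest`) — so `radialDeriv` is the cycle-weighted block sum `Σ_B (|B|−1)!(1−β_B)Φ_{T∖B}` of (R2)
(through the last index; the other blocks by relabelling). [this work] -/
theorem slope_eq_of_last_mem {k : ℕ} (β : Finset (Fin (k + 1)) → ℝ) {B : Finset (Fin (k + 1))} (hB : Fin.last k ∈ B) :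
    slope (k + 1) β B = ((B.card - 1).factorial : ℝ) * coRest (realW β) realF B := by
  set F := univ.filter (fun B' : Finset (Fin (k + 1)) => Fin.last k ∈ B') with hF
  have hBF : B ∈ F := mem_filter.2 ⟨mem_univ _, hB⟩
  set C := ∑ B' ∈ F.erase B, ((B'.card - 1).factorial : ℝ) * (β B' * coRest (realW β) realF B') with hC
  set κ := coRest (realW β) realF B with hκ
  -- the function `x ↦ Φ(β with β_B := x)` is affine with slope `(|B|−1)!·κ_B(β)`
  have hg : ∀ x, phiSet (k + 1) (update β B x) = ((B.card - 1).factorial : ℝ) * (x * κ) + C := by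
    intro x
    have hoff : ∀ S, Fin.last k ∉ S → update β B x S = β S := fun S hS =>
      update_of_ne (fun h => hS (by rw [h]; exact hB)) _ _
    rw [phiSet_eq_sum_blocks_last, ← add_sum_erase F _ hBF, update_self, coRest_congr_off_last hoff hB]
    congr 1
    refine sum_congr rfl fun B' hB' => ?_
    have hne : B' ≠ B := (mem_erase.1 hB').1
    have hl : Fin.last k ∈ B' := (mem_filter.1 (mem_erase.1 hB').2).2
    rw [update_of_ne hne, coRest_congr_off_last hoff hl]
  have h1 : HasDerivAt (fun x => phiSet (k + 1) (update β B x)) (((B.card - 1).factorial : ℝ) * (1 * κ)) (β B) := by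
    have e : (fun x => phiSet (k + 1) (update β B x)) = fun x => ((B.card - 1).factorial : ℝ) * (x * κ) + C := funext hg
    rw [e]
    exact (((hasDerivAt_id (β B)).mul_const κ).const_mul _).add_const C
  have h2 := hasDerivAt_phiSet_update β B (β B)
  rw [update_eq_self] at h2
  have := h2.unique h1
  rw [this, one_mul]

/-! ### Relabelling, and the EDGE IDENTIFICATION `r2Slack 𝒰 𝒱 w = radialDeriv (w1_𝒰 + (1−w)1_𝒱)` -/

/-- No block of a set partition is empty, so the slope at `∅` vanishes. [this work] -/
theorem slope_empty {k : ℕ} (β : Finset (Fin (k + 1)) → ℝ) : slope (k + 1) β ∅ = 0 := by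
  refine sum_eq_zero fun c _ => ?_
  rw [sum_eq_zero fun j _ => ?_, mul_zero]
  have hne : PartitionForm.block c j ≠ ∅ := by
    rw [← Finset.nonempty_iff_ne_empty, ← Finset.card_pos, PartitionForm.card_block]; exact c.partSize_pos j
  rw [if_neg hne, mul_zero, mul_zero]

/-- Updating commutes with relabelling. [this work] -/
theorem update_actV {k : ℕ} (σ : Perm (Fin (k + 1))) (β : Finset (Fin (k + 1)) → ℝ) (B : Finset (Fin (k + 1))) (x : ℝ) :
    update (PhiCert.actV σ β) B x = PhiCert.actV σ (update β (B.map σ.toEmbedding) x) := by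
  funext S; unfold PhiCert.actV
  by_cases hS : S = B
  · rw [hS, update_self, update_self]
  · rw [update_of_ne hS, update_of_ne (fun h => hS (Finset.map_injective _ h))]

/-- **Equivariance of the slope**: `∂_BΦ(β ∘ σ) = (∂_{σB}Φ)(β)`. [this work] -/
theorem slope_actV {k : ℕ} (σ : Perm (Fin (k + 1))) (β : Finset (Fin (k + 1)) → ℝ) (B : Finset (Fin (k + 1))) :
    slope (k + 1) (PhiCert.actV σ β) B = slope (k + 1) β (B.map σ.toEmbedding) := by
  have h1 := hasDerivAt_phiSet_update (PhiCert.actV σ β) B (PhiCert.actV σ β B)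
  have h2 := hasDerivAt_phiSet_update β (B.map σ.toEmbedding) (β (B.map σ.toEmbedding))
  rw [update_eq_self] at h1 h2
  have e : (fun x => phiSet (k + 1) (update (PhiCert.actV σ β) B x)) =
      fun x => phiSet (k + 1) (update β (B.map σ.toEmbedding) x) := by
    funext x; rw [update_actV, PhiCert.phiSet_actV]
  rw [e] at h1
  exact h1.unique h2

/-- The rooted mixture is the relabelled mixture. [this work] -/
theorem mix_rooted_eq_actV (z : Fin (n + 1)) (𝒰 𝒱 : Finset (Finset (Fin (n + 1)))) (w : ℝ) :
    mix (rooted z 𝒰) (rooted z 𝒱) w = PhiCert.actV (Equiv.swap z (Fin.last n)) (mix 𝒰 𝒱 w) := by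
  unfold rooted PhiCert.actV; rw [← mix_map]

/-- A block term of the rooted pair through the last index is `(1 − β_{B'})·(−∂_{B'}Φ(β))` at the relabelled block `B' = swap(B) ∋ z`
of the ORIGINAL pair. [this work] -/
theorem blockTerm_rooted_eq (z : Fin (n + 1)) (𝒰 𝒱 : Finset (Finset (Fin (n + 1)))) (w : ℝ) {B : Finset (Fin (n + 1))}
    (hB : Fin.last n ∈ B) :
    blockTerm (rooted z 𝒰) (rooted z 𝒱) B w =
      (1 - mix 𝒰 𝒱 w (B.map (Equiv.swap z (Fin.last n)).toEmbedding)) *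
        (-slope (n + 1) (mix 𝒰 𝒱 w) (B.map (Equiv.swap z (Fin.last n)).toEmbedding)) := by
  unfold blockTerm
  have hs := slope_eq_of_last_mem (mix (rooted z 𝒰) (rooted z 𝒱) w) hB
  rw [mix_rooted_eq_actV, slope_actV] at hs
  rw [mix_rooted_eq_actV, hs]
  unfold PhiCert.actV
  ring

/-- The two block sums of `r2Slack` at one root merge into one sum over the proper blocks through the last index. [this work] -/
theorem sum_good_add_bad (𝒰 𝒱 : Finset (Finset (Fin (n + 1)))) (f : Finset (Fin (n + 1)) → ℝ) :
    (∑ B ∈ goodBlocks 𝒰 𝒱, f B) + ∑ B ∈ badBlocks 𝒰 𝒱, f B =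
      ∑ B ∈ univ.filter (fun B : Finset (Fin (n + 1)) => Fin.last n ∈ B ∧ B ≠ univ), f B := by
  rw [← Finset.sum_filter_add_sum_filter_not (univ.filter fun B : Finset (Fin (n + 1)) => Fin.last n ∈ B ∧ B ≠ univ)
    (fun B => ¬(univ \ B ∉ 𝒰 ∧ univ \ B ∉ 𝒱)) f]
  unfold goodBlocks badBlocks
  rw [Finset.filter_filter, Finset.filter_filter]
  congr 1
  · refine Finset.sum_congr ?_ fun _ _ => rfl
    ext B; simp only [mem_filter, mem_univ, true_and, and_assoc]
  · refine Finset.sum_congr ?_ fun _ _ => rfl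
    ext B; simp only [mem_filter, mem_univ, true_and, and_assoc, not_not]

/-- **EDGE IDENTIFICATION**: for a pair with `univ` in both families, the typed (R2) slack of `…GoodDominatesDebt` IS the radial derivative at the
edge point: `r2Slack 𝒰 𝒱 w = radialDeriv (n+1) (w1_𝒰 + (1−w)1_𝒱)`.  Hence `R2Hull n` gives (R2) pointwise on every edge, and (R2) is literally
`d/ds Φ(𝟙 + s(β − 𝟙))|_{s=1}` as claimed in P4-GEN28. [this work] -/
theorem r2Slack_eq_radialDeriv (𝒰 𝒱 : Finset (Finset (Fin (n + 1)))) (hU : univ ∈ 𝒰) (hV : univ ∈ 𝒱) (w : ℝ) :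
    GoodDebt.r2Slack 𝒰 𝒱 w = radialDeriv (n + 1) (mix 𝒰 𝒱 w) := by
  set β := mix 𝒰 𝒱 w with hβ
  have hβu : β univ = 1 := by
    show mix 𝒰 𝒱 w univ = 1
    unfold mix; rw [if_pos hU, if_pos hV]; ring
  -- the summand as a function of an arbitrary block
  set F : Finset (Fin (n + 1)) → ℝ := fun B' => (B'.card : ℝ)⁻¹ * ((1 - β B') * (-slope (n + 1) β B')) with hF
  -- Step 1: each root contributes `Σ_{B' ∋ z, B' ≠ univ} F B'`
  have hroot : ∀ z : Fin (n + 1),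
      ((∑ B ∈ goodBlocks (rooted z 𝒰) (rooted z 𝒱), (B.card : ℝ)⁻¹ * blockTerm (rooted z 𝒰) (rooted z 𝒱) B w) +
        ∑ B ∈ badBlocks (rooted z 𝒰) (rooted z 𝒱), (B.card : ℝ)⁻¹ * blockTerm (rooted z 𝒰) (rooted z 𝒱) B w) =
      ∑ B' : Finset (Fin (n + 1)), if z ∈ B' ∧ B' ≠ univ then F B' else 0 := by
    intro z
    set σ := Equiv.swap z (Fin.last n) with hσ
    rw [sum_good_add_bad, sum_filter]
    -- reindex `B ↦ B.map σ`
    have hre : ∑ B : Finset (Fin (n + 1)), (if Fin.last n ∈ B ∧ B ≠ univ then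
        (B.card : ℝ)⁻¹ * blockTerm (rooted z 𝒰) (rooted z 𝒱) B w else 0) =
        ∑ B : Finset (Fin (n + 1)), (if z ∈ B.map σ.toEmbedding ∧ B.map σ.toEmbedding ≠ univ then F (B.map σ.toEmbedding) else 0) := by
      refine sum_congr rfl fun B _ => ?_
      have hz : z ∈ B.map σ.toEmbedding ↔ Fin.last n ∈ B := by
        rw [Finset.mem_map_equiv, hσ, Equiv.symm_swap, Equiv.swap_apply_left]
      have hu : B.map σ.toEmbedding = univ ↔ B = univ :=
        ⟨fun h => Finset.map_injective _ (by rw [h, Finset.map_univ_equiv]), fun h => by rw [h, Finset.map_univ_equiv]⟩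
      by_cases hl : Fin.last n ∈ B
      · by_cases hBu : B = univ
        · rw [if_neg (fun h => h.2 hBu), if_neg (fun h => h.2 (hu.2 hBu))]
        · rw [if_pos ⟨hl, hBu⟩, if_pos ⟨hz.2 hl, fun h => hBu (hu.1 h)⟩, hF]
          simp only
          rw [blockTerm_rooted_eq z 𝒰 𝒱 w hl, Finset.card_map]
      · rw [if_neg (fun h => hl h.1), if_neg (fun h => hl (hz.1 h.1))]
    rw [hre]
    exact Equiv.sum_comp (Equiv.finsetCongr σ) (fun B' => if z ∈ B' ∧ B' ≠ univ then F B' else 0)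
  -- Step 2: sum over roots, swap, and count `#{z ∈ B'} = |B'|`
  unfold GoodDebt.r2Slack
  rw [sum_congr rfl fun z _ => hroot z, Finset.sum_comm]
  rw [radialDeriv_eq_sum_slope]
  refine sum_congr rfl fun B' _ => ?_
  by_cases hBu : B' = univ
  · rw [hBu, hβu, sub_self, zero_mul]; exact sum_eq_zero fun z _ => by rw [if_neg (fun h => h.2 rfl)]
  by_cases hBe : B' = ∅
  · rw [hBe, slope_empty, mul_zero]; exact sum_eq_zero fun z _ => by rw [if_neg (fun h => Finset.notMem_empty _ h.1)]
  have hc : (B'.card : ℝ) ≠ 0 := Nat.cast_ne_zero.2 (Finset.card_ne_zero.2 (Finset.nonempty_iff_ne_empty.2 hBe))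
  have e1 : ∑ z : Fin (n + 1), (if z ∈ B' ∧ B' ≠ univ then F B' else 0) = ∑ z ∈ B', F B' := by
    rw [← sum_filter]
    refine sum_congr ?_ fun _ _ => rfl
    ext z; simp only [mem_filter, mem_univ, true_and, hBu, ne_eq, not_false_eq_true, and_true]
  rw [e1, sum_const, nsmul_eq_mul, hF]
  simp only
  field_simp
  ring

end RadialDeriv

end Summit.CriticalPhenomena.PercolationContinuityZ3.Theorems
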